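import Mathlib
import Summits.ValiantsHypothesis.ValiantsHypothesis.Theses.ChowBorderDepth3

/-!
# Stub `stub_rescale` of crux `ChowBorderDepth3.ChowBorderBound` (stmt-ValiantsHypothesis-5936),
# line `registered` (vertex normal form)

The third (and last) normalisation step towards the vertex normal form of a border `ΣΠΣ`
expression of the padded permanent over `ℂ[ε]` (`ε = Polynomial.X`).  Suppose

  `Σ_i a_i(ε) Π_j (c_ij(ε) + Σ_v L_ijv(ε) x_v) = ε^q · per_n + ε^(q+1) · G`

with all constant terms `c_ij ≠ 0` and `G` homogeneous of degree `n`.  Then there is a *local*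
expression `Σ_i a'_i(ε) Π_j (1 + Σ_v m_ijv(ε) x_v) = ε^q' · per_n + ε^(q'+1) · G'` with every
`m_ijv` divisible by `ε`.

## Proof

1. Write `c_ij = ε^(e_ij) w_ij` with `ε ∤ w_ij` and pick `N > e_ij` for all `i, j`.
2. Truncated inverses: `ε` is irreducible in the principal ideal domain `ℂ[ε]`, so `w_ij` is
   coprime to `ε^M` (`M = q + N n + 1`): `β_ij w_ij + α_ij ε^M = 1`.
3. Rescale `x_v ↦ ε^N x_v` (an algebra endomorphism); by homogeneity the right-hand side becomes
   `ε^(q+Nn) per_n + ε^(q+Nn+1) G`, and each affine factor becomes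
   `c_ij (1 + Σ_v m_ijv x_v) + ε^M B_ij` with `m_ijv = ε^(N-e_ij) β_ij L_ijv` (divisible by `ε`).
4. Expanding the products, `Π_j (A_j + ε^M B_j) = Π_j A_j + ε^M E`, and the error terms are
   absorbed into `G' = G - Σ_i a_i E_i`, with `a'_i = a_i Π_j c_ij`, `q' = q + N n`.

References: M. Kumar, *On the power of border of depth-3 arithmetic circuits*, ACM ToCT 12 (2020),
doi:10.1145/3371506, §2 (the local normal form); J. M. Landsberg, *Geometry and complexity
theory*, CUP 2017, §7.5.
-/

noncomputable section

-- `Summit.ValiantsHypothesis.ValiantsHypothesis.…` is the tree's mandated single-conjunct layout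
-- (Sub = Summit), so the duplicated namespace component is intended.
set_option linter.dupNamespace false

namespace Summit.ValiantsHypothesis.ValiantsHypothesis.Theorems.ChowBorderBound.Rescale

open MvPolynomial Literature.Computability.AlgebraicComplexity
open scoped Polynomial

/-- Rescaling the variables of a homogeneous polynomial of degree `k` by a scalar `t` multiplies
it by `t ^ k`. [folklore] -/
theorem aeval_C_mul_X_of_isHomogeneous {σ S : Type*} [CommSemiring S] (t : S)
    {φ : MvPolynomial σ S} {k : ℕ} (hφ : φ.IsHomogeneous k) :
    aeval (fun v => C t * X v) φ = C (t ^ k) * φ := by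
  classical
  conv_lhs => rw [φ.as_sum]
  conv_rhs => rw [φ.as_sum]
  rw [map_sum, Finset.mul_sum]
  refine Finset.sum_congr rfl fun d hd => ?_
  rw [aeval_monomial, algebraMap_eq, monomial_eq, Finsupp.prod, Finsupp.prod]
  simp_rw [mul_pow]
  rw [Finset.prod_mul_distrib, Finset.prod_pow_eq_pow_sum, ← hφ.degree_eq_sum_deg_support hd,
    map_pow]
  ring

/-- First-order expansion of a product of perturbed factors:
`Π_j (A_j + t B_j) = Π_j A_j + t E` for some `E`. [folklore] -/
theorem exists_prod_add_mul_eq {R ι : Type*} [CommSemiring R] (s : Finset ι) (A B : ι → R)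
    (t : R) : ∃ E : R, ∏ j ∈ s, (A j + t * B j) = ∏ j ∈ s, A j + t * E := by
  classical
  induction s using Finset.induction_on with
  | empty => exact ⟨0, by simp⟩
  | insert j s hj ih =>
    obtain ⟨E, hE⟩ := ih
    refine ⟨A j * E + B j * ∏ i ∈ s, A i + t * B j * E, ?_⟩
    rw [Finset.prod_insert hj, Finset.prod_insert hj, hE]
    ring

/-- **Stub `stub_rescale`** (registered stub of crux stmt-ValiantsHypothesis-5936, line
`registered`): a border `ΣΠΣ` expression `Σ_i a_i Π_j (c_ij + L_ij(x)) = ε^q per_n + ε^(q+1) G`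
over `ℂ[ε]` with all `c_ij ≠ 0` and `G` homogeneous of degree `n` can be rewritten in the local
(vertex) form
`Σ_i a'_i Π_j (1 + m_ij(x)) = ε^q' per_n + ε^(q'+1) G'` with every coefficient of every `m_ij`
divisible by `ε` (rescale `x ↦ ε^N x` and divide each factor by `c_ij` using a truncated inverse
of its `ε`-free part). -/
theorem stub_rescale :
    ∀ n r D : ℕ,
    (∃ (q : ℕ) (a : Fin r → Polynomial ℂ) (c : Fin r → Fin D → Polynomial ℂ)
        (L : Fin r → Fin D → Fin n × Fin n → Polynomial ℂ)
        (G : MvPolynomial (Fin n × Fin n) (Polynomial ℂ)),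
        (∀ i j, c i j ≠ 0) ∧ G.IsHomogeneous n ∧
        (∑ i, MvPolynomial.C (a i) *
            ∏ j, (MvPolynomial.C (c i j) + ∑ v, MvPolynomial.C (L i j v) * MvPolynomial.X v)) =
          MvPolynomial.C (Polynomial.X ^ q) *
              MvPolynomial.map Polynomial.C
                (Literature.Computability.AlgebraicComplexity.perPoly (Fin n) ℂ) +
            MvPolynomial.C (Polynomial.X ^ (q + 1)) * G) →
    ∃ (q : ℕ) (a : Fin r → Polynomial ℂ) (m : Fin r → Fin D → Fin n × Fin n → Polynomial ℂ)
      (G : MvPolynomial (Fin n × Fin n) (Polynomial ℂ)),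
      (∀ i j v, Polynomial.X ∣ m i j v) ∧
      (∑ i, MvPolynomial.C (a i) *
          ∏ j, (1 + ∑ v, MvPolynomial.C (m i j v) * MvPolynomial.X v)) =
        MvPolynomial.C (Polynomial.X ^ q) *
            MvPolynomial.map Polynomial.C
              (Literature.Computability.AlgebraicComplexity.perPoly (Fin n) ℂ) +
          MvPolynomial.C (Polynomial.X ^ (q + 1)) * G := by
  intro n r D
  rintro ⟨q, a, c, L, G, hc, hG, H⟩
  classical
  set Per : MvPolynomial (Fin n × Fin n) ℂ[X] :=
    MvPolynomial.map Polynomial.C (perPoly (Fin n) ℂ) with hPer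
  have hPerHom : Per.IsHomogeneous n := by
    simpa only [Fintype.card_fin] using
      (perPoly_isHomogeneous (n := Fin n) (k := ℂ)).map Polynomial.C
  -- Step 1: `c i j = ε^(e i j) * w i j` with `ε ∤ w i j`
  have hcw : ∀ i j, ∃ (e : ℕ) (w : ℂ[X]), c i j = Polynomial.X ^ e * w ∧ ¬ Polynomial.X ∣ w := by
    intro i j
    obtain ⟨w, h1, h2⟩ :=
      Polynomial.exists_eq_pow_rootMultiplicity_mul_and_not_dvd (c i j) (hc i j) 0
    rw [map_zero, sub_zero] at h1 h2
    exact ⟨_, w, h1, h2⟩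
  choose e w hcw hnd using hcw
  -- Step 2: a uniform bound `N > e i j`
  obtain ⟨N, heN⟩ : ∃ N : ℕ, ∀ i j, e i j < N :=
    ⟨Finset.univ.sup (fun p : Fin r × Fin D => e p.1 p.2) + 1, fun i j =>
      Nat.lt_succ_of_le
        (Finset.le_sup (f := fun p : Fin r × Fin D => e p.1 p.2) (Finset.mem_univ (i, j)))⟩
  -- Step 3: truncated inverses `β i j * w i j + α i j * ε^M = 1`, `M = q + N n + 1`
  have hinv : ∀ i j, ∃ α β : ℂ[X], β * w i j + α * Polynomial.X ^ (q + N * n + 1) = 1 := by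
    intro i j
    obtain ⟨β, α, h⟩ := Polynomial.irreducible_X.coprime_pow_of_not_dvd (q + N * n + 1) (hnd i j)
    exact ⟨α, β, h⟩
  choose α β hαβ using hinv
  -- the new linear forms, the main terms `A` and the error terms `B` of the rescaled factors
  obtain ⟨m, hm⟩ : ∃ m : Fin r → Fin D → Fin n × Fin n → ℂ[X],
      ∀ i j v, m i j v = Polynomial.X ^ (N - e i j) * β i j * L i j v := ⟨_, fun _ _ _ => rfl⟩
  obtain ⟨A, hA⟩ : ∃ A : Fin r → Fin D → MvPolynomial (Fin n × Fin n) ℂ[X],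
      ∀ i j, A i j = C (c i j) * (1 + ∑ v, C (m i j v) * X v) := ⟨_, fun _ _ => rfl⟩
  obtain ⟨B, hB⟩ : ∃ B : Fin r → Fin D → MvPolynomial (Fin n × Fin n) ℂ[X],
      ∀ i j, B i j = ∑ v, C (Polynomial.X ^ N * α i j * L i j v) * X v := ⟨_, fun _ _ => rfl⟩
  -- Step 4: the factor identity after rescaling
  have hfac : ∀ i j, C (c i j) + ∑ v, C (L i j v) * (C (Polynomial.X ^ N) * X v) =
      A i j + C (Polynomial.X ^ (q + N * n + 1)) * B i j := by
    intro i j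
    rw [hA, hB, mul_add, mul_one, Finset.mul_sum, Finset.mul_sum, add_assoc,
      ← Finset.sum_add_distrib]
    congr 1
    refine Finset.sum_congr rfl fun v _ => ?_
    have hpow : (Polynomial.X : ℂ[X]) ^ N = Polynomial.X ^ e i j * Polynomial.X ^ (N - e i j) := by
      rw [← pow_add, Nat.add_sub_cancel' (heN i j).le]
    have key : L i j v * Polynomial.X ^ N = c i j * m i j v +
        Polynomial.X ^ (q + N * n + 1) * (Polynomial.X ^ N * α i j * L i j v) := by
      rw [hm, hcw i j]
      linear_combination (w i j * β i j * L i j v) * hpow +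
        (-(L i j v * Polynomial.X ^ N)) * hαβ i j
    have h1 : C (L i j v) * (C (Polynomial.X ^ N) * X v) =
        (C (L i j v * Polynomial.X ^ N) : MvPolynomial (Fin n × Fin n) ℂ[X]) * X v := by
      rw [map_mul, mul_assoc]
    rw [h1, key, map_add, map_mul, map_mul]
    ring
  -- Step 5: rescale the identity by `x_v ↦ ε^N x_v`
  set ρ := aeval (R := ℂ[X])
    (fun v : Fin n × Fin n => (C (Polynomial.X ^ N) * X v : MvPolynomial (Fin n × Fin n) ℂ[X]))
    with hρ
  have hρC : ∀ p : ℂ[X], ρ (C p) = C p := fun p => by rw [hρ, aeval_C, algebraMap_eq]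
  have hρX : ∀ v, ρ (X v) = C (Polynomial.X ^ N) * X v := fun v => by rw [hρ, aeval_X]
  have hρhom : ∀ (φ : MvPolynomial (Fin n × Fin n) ℂ[X]) (k : ℕ), φ.IsHomogeneous k →
      ρ φ = C ((Polynomial.X ^ N) ^ k) * φ := fun φ k hφ => by
    rw [hρ, aeval_C_mul_X_of_isHomogeneous _ hφ]
  have hL : ρ (∑ i, C (a i) * ∏ j, (C (c i j) + ∑ v, C (L i j v) * X v)) =
      ∑ i, C (a i) * ∏ j, (A i j + C (Polynomial.X ^ (q + N * n + 1)) * B i j) := by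
    rw [map_sum]
    refine Finset.sum_congr rfl fun i _ => ?_
    rw [map_mul, hρC, map_prod]
    refine congrArg _ (Finset.prod_congr rfl fun j _ => ?_)
    rw [← hfac, map_add, hρC, map_sum]
    refine congrArg _ (Finset.sum_congr rfl fun v _ => ?_)
    rw [map_mul, hρC, hρX]
  have hR : ρ (C (Polynomial.X ^ q) * Per + C (Polynomial.X ^ (q + 1)) * G) =
      C (Polynomial.X ^ (q + N * n)) * Per + C (Polynomial.X ^ (q + N * n + 1)) * G := by
    rw [map_add, map_mul, map_mul, hρC, hρC, hρhom Per n hPerHom, hρhom G n hG]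
    simp only [map_pow]
    ring
  have hres := congrArg ρ H
  rw [hL, hR] at hres
  -- Step 6: expand the products to first order in `ε^M`
  have hE := fun i => exists_prod_add_mul_eq Finset.univ (A i) (B i)
    (C (Polynomial.X ^ (q + N * n + 1)))
  choose E hE using hE
  simp only [hE, mul_add, Finset.sum_add_distrib] at hres
  -- Step 7: assemble
  refine ⟨q + N * n, fun i => a i * ∏ j, c i j, m, G - ∑ i, C (a i) * E i, ?_, ?_⟩
  · intro i j v
    rw [hm]
    exact ((dvd_pow_self _ (Nat.sub_ne_zero_of_lt (heN i j))).mul_right _).mul_right _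
  have hAprod : ∀ i, C (a i * ∏ j, c i j) * ∏ j, (1 + ∑ v, C (m i j v) * X v) =
      C (a i) * ∏ j, A i j := by
    intro i
    simp only [hA, Finset.prod_mul_distrib, map_mul, map_prod]
    ring
  rw [Finset.sum_congr rfl fun i _ => hAprod i]
  have hS : ∑ i, C (a i) * (C (Polynomial.X ^ (q + N * n + 1)) * E i) =
      C (Polynomial.X ^ (q + N * n + 1)) * ∑ i, C (a i) * E i := by
    rw [Finset.mul_sum]
    exact Finset.sum_congr rfl fun i _ => by ring
  linear_combination hres - hS

end Summit.ValiantsHypothesis.ValiantsHypothesis.Theorems.ChowBorderBound.Rescale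

end
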